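import Summits.BirchSwinnertonDyer.BirchSwinnertonDyer.Theorems.GenusKolyvaginAtTwoGenusPrimitiveSupplyAtTwoDoorSupplyPosDisc
import Summits.BirchSwinnertonDyer.BirchSwinnertonDyer.Theorems.GenusKolyvaginAtTwoGenusPrimitiveSupplyAtTwoDoorSupplyNegDiscSha
import Summits.BirchSwinnertonDyer.BirchSwinnertonDyer.Theorems.GenusKolyvaginAtTwoGenusPrimitiveSupplyAtTwoSilentPrimesNoTwoTorsion
import Literature.NumberTheory.EllipticCurves.BSDSha
import HarnessLib

/-!
# Route `GenusKolyvaginAtTwo`, crux #2 `GenusPrimitiveSupplyAtTwo` (stmt-BirchSwinnertonDyer-22136):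
# `RankOneAtTwoOneDoor.DoorSupplyAtTwo` BY NAME MODULO THE FINITENESS OF `Ш` — the `L`-free door supply for EVERY rank-one `W/ℚ`
# with `E(ℚ)[2] = 0` whose `Ш(W)[2^∞]` is finite (both signs of `Δ`, square `Δ` included, `Ш(W)[2] ≠ 0` allowed)

Width seat `bsd-line-gk2-p4` g15 (cell `bsd-f1-sign2`). THEOREMS ONLY (no definition, no named fact, no `sorry`); helper
`--supports stmt-BirchSwinnertonDyer-22136`; no item is closed; BSD is not proved by any of this.

ASSEMBLY of this lineage's supply files — `…DoorSupplyNegDisc` (p680217: `Δ < 0`, `#Sel₂ = 2^k`, `k` odd — iterated prime Heegner twins,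
Mazur–Rubin Cor. 3.4 (i)), `…DoorSupplyPosDisc` (p681859: `Δ > 0` — THEOREM A + the Thm. 1.5 identity-prime walk, there under `Δ ∉ ℚ²`),
`…SilentPrimesNoTwoTorsion` (silent admissible primes from `E(ℚ)[2] = 0` ALONE, witness `c₀·τ²`) and `…DoorSupplyNegDiscSha` (p681913:
`#Sel₂(W) = 2^{2r+1}` for rank one, `E(ℚ)[2] = 0`, `Ш(W)[2^∞]` finite):

* §59 `exists_doorAdmissible_twistSelmerTwoCard_eq_one_of_posDisc_of_noRationalTwoTorsion` — §52 of `…DoorSupplyPosDisc` WITHOUT `Δ ∉ ℚ²`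
  (same proof, the silent prime now from `exists_descAdmissible_neg_prime_of_noRationalTwoTorsion`);
* §60 `exists_doorAdmissible_twistSelmerTwoCard_eq_one_of_odd` — EVERY globally minimal `W` with `E(ℚ)[2] = 0` and `#Sel₂(W) = 2^k`, `k` odd;
* §61 `exists_doorAdmissible_twistSelmerTwoCard_eq_one_of_rank_one_of_finite` / `…_of_shaFinite` / `…_of_shaTwoTrivial` — rank one, `Ш(W)[2^∞]`
  finite (resp. `Ш(W)` finite, resp. `Ш(W)[2] = 0` — the slice, now without `Δ ∉ ℚ²`); **`doorSupplyAtTwo_of_forall_finite_primaryComponent`** — `DoorSupplyAtTwo` from «`Ш(W)[2^∞]` finite for every rank-one `W` with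
  `E(ℚ)[2] = 0`»; **`doorSupplyAtTwo_of_shaFiniteConjecture : ShaFiniteConjecture → DoorSupplyAtTwo`** — the fkl line's AN-27 supply `Prop` BY NAME
  modulo the registered conjecture `Literature…ShaFiniteConjecture` (finiteness of `Ш(E/ℚ)`; on the analytic-rank-one habitat of the fkl glue this is
  Kolyvagin's theorem, carried there by `S_pub`). CONDITIONAL on that one hypothesis; every other input is a tree theorem.

Why `Ш` finite cannot be dropped: with `Ш(W)[2^∞]` infinite `dim Sel₂(W)` may be even, and then every Heegner twist (root number flipped) has odd,
hence non-zero, `dim Sel₂`. References: Mazur–Rubin, Invent. Math. 181 (2010), Prop. 3.3, Cor. 3.4, Lemma 3.5, Lemma 3.6, Prop. 5.2, Thm. 1.5; Kramer,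
Trans. AMS 264 (1981), Prop. 3, Prop. 6; Cassels, Crelle 211 (1962), §1; Silverman *AEC* Thm. X.4.14; Tate 1974 Conj. 1.
-/

set_option linter.dupNamespace false -- tree convention: `Summit.BirchSwinnertonDyer.BirchSwinnertonDyer.Theorems` (summit = sub-problem)
set_option autoImplicit false

noncomputable section

open scoped Classical

namespace Summit.BirchSwinnertonDyer.BirchSwinnertonDyer.Theorems.GenusKolyTransp

open WeierstrassCurve Field NumberField IsDedekindDomain Function
open Literature.NumberTheory.EllipticCurves Literature.NumberTheory.GaloisRepresentations Literature.NumberTheory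
open Literature.NumberTheory.QuadraticFields (Quadratic.exists_numberField_discr_eq Quadratic.isTotallyComplex_of_discr_neg
  Quadratic.ncard_primesOver_eq_two_iff_jacobiSym Quadratic.ncard_primesOver_two_eq_two_iff)
open Summit.BirchSwinnertonDyer.Rank1Residual.F1Sign2
open Summit.BirchSwinnertonDyer.Rank1Residual.F1Sign2.EggDoubling (eq_zero_of_two_smul_eq_zero)
open Summit.BirchSwinnertonDyer.BirchSwinnertonDyer.Theorems.RankOneAtTwoOneDoor (DoorAdmissible DoorSupplyAtTwo)
open Summit.BirchSwinnertonDyer.BirchSwinnertonDyer.Theorems.GenusKolyArch (admissibleTwistSelmerShiftAtTwo_holds)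
open Summit.BirchSwinnertonDyer.BirchSwinnertonDyer.Theorems.GenusKolyLowering (exists_squarefree_twist_card_selmerGroup_eq_of_duality
  natCard_torsionBy_two_eq_one_iff natCard_torsionBy_two_quadraticTwist_eq_one localEP)
open Summit.BirchSwinnertonDyer.BirchSwinnertonDyer.Theorems.SchneiderFreeAdditiveX3.PoitouTateReduction (poitouTate_selmerStructure_duality_real_holds)

/-! ## §59 The door at `Δ > 0` for every odd `2`-Selmer dimension, `E(ℚ)[2] = 0` only -/

/-- **THE DOOR SUPPLY AT `Δ > 0` FOR EVERY ODD `2`-SELMER DIMENSION, NO IMAGE HYPOTHESIS.** `W/ℚ` globally minimal elliptic, `Δ_W > 0`,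
`E(ℚ)[2] = 0`, `#Sel₂(W) = 2^k` with `k` odd (`Ш(W)[2] ≠ 0` allowed; `Δ_W` a square allowed): there is an imaginary quadratic `K` with `d_K`
door-admissible, `#Sel₂(W^{(d_K)}) = 1`, `(d_K, N_W) = 1` and the Heegner hypothesis for `N_W` — `…DoorSupplyPosDisc` §52 verbatim with the silent
prime taken from `exists_descAdmissible_neg_prime_of_noRationalTwoTorsion`. [cite: MazurRubin2010, Lemma 3.6, Prop. 5.2, Thm. 1.5]
[cite: Kramer1981, Prop. 3 and Prop. 6] [cite: Monsky1996, Thm. 1.5] -/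
theorem exists_doorAdmissible_twistSelmerTwoCard_eq_one_of_posDisc_of_noRationalTwoTorsion (W : WeierstrassCurve ℚ) [W.IsElliptic]
    [W.IsGloballyMinimal] [NeZero (W.conductorNorm ℤ)] (hΔ : 0 < W.Δ) (hT : NoRationalTwoTorsion W) {k : ℕ}
    (hk : Nat.card (W.selmerGroup 2) = 2 ^ k) (hodd : Odd k) :
    ∃ (K : Type) (_ : Field K) (_ : NumberField K),
      IsImaginaryQuadratic K ∧ DoorAdmissible W (NumberField.discr K) ∧ twistSelmerTwoCard W (NumberField.discr K) = 1 ∧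
      Nat.Coprime (NumberField.discr K).natAbs (W.conductorNorm ℤ) ∧ SatisfiesHeegnerHypothesis (W.conductorNorm ℤ) K := by
  have hN : W.conductorNorm ℤ ≠ 0 := (W.conductorNorm_pos_holds).ne'
  -- Step 1: a silent admissible prime `ℓ` (no image hypothesis: `…SilentPrimesNoTwoTorsion`); THEOREM A makes `#Sel₂(W^{(−ℓ)})` an even power of `2`
  obtain ⟨ℓ, -, hℓ, hℓN, hdesc⟩ := exists_descAdmissible_neg_prime_of_noRationalTwoTorsion W hΔ hT 0
  obtain ⟨j, hj⟩ : ∃ j : ℕ, twistSelmerTwoCard W (-(ℓ : ℤ)) = 2 ^ (0 + 2 * j) := by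
    obtain ⟨i, rfl⟩ := hodd
    have hA := admissibleTwistSelmerShiftAtTwo_holds W hΔ hT (-(ℓ : ℤ)) hdesc
    unfold selmerTwoCard at hA
    rw [hk] at hA
    rcases hA with h | h
    · refine ⟨i, Nat.eq_of_mul_eq_mul_left zero_lt_two ?_⟩
      rw [h, zero_add, pow_succ, mul_comm]
    · exact ⟨i + 1, by rw [h]; ring⟩
  -- Step 2: the Mazur–Rubin walk on `V = W^{(−ℓ)}` with modulus `8 N_W ℓ`
  have hℓ0 : (((-(ℓ : ℤ) : ℤ)) : ℚ) ≠ 0 := by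
    push_cast
    exact neg_ne_zero.mpr (by exact_mod_cast hℓ.ne_zero)
  haveI := W.isElliptic_quadraticTwist hℓ0
  have htorsW : Nat.card (AddSubgroup.torsionBy W.toAffine.Point ((2 : ℕ) : ℤ)) = 1 := by
    refine natCard_torsionBy_two_eq_one_iff.mpr fun P hP ↦ ?_
    have h := eq_zero_of_two_smul_eq_zero W hT P
    convert h (by convert hP)
  have htorsV := natCard_torsionBy_two_quadraticTwist_eq_one W hℓ0 htorsW
  have hSelV : Nat.card ((W.quadraticTwist (((-(ℓ : ℤ) : ℤ)) : ℚ)).selmerGroup 2) = 2 ^ (0 + 2 * j) := hj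
  have hm : 8 * W.conductorNorm ℤ * ℓ ≠ 0 := mul_ne_zero (mul_ne_zero (by norm_num) hN) hℓ.ne_zero
  obtain ⟨u, hu, hum, hSelu⟩ := exists_squarefree_twist_card_selmerGroup_eq_of_duality
    (poitouTate_selmerStructure_duality_real_holds (K := ℚ)) (localEP ℚ) (W.quadraticTwist (((-(ℓ : ℤ) : ℤ)) : ℚ)) htorsV hSelV hm
  -- bookkeeping on `u`
  have hu0 : u ≠ 0 := fun h ↦ by rw [h] at hu; exact not_squarefree_zero hu
  have humod : ∀ n : ℤ, n ∣ ((8 * W.conductorNorm ℤ * ℓ : ℕ) : ℤ) → (u : ℤ) % n = 1 % n := fun n hn ↦ Int.ModEq.of_dvd hn hum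
  have hu_ndvd : ∀ q : ℕ, q.Prime → q ∣ u → ¬ q ∣ 8 * W.conductorNorm ℤ * ℓ := fun q hq hqu hqm ↦ by
    have h1 : (u : ℤ) % q = 1 % q := humod q (by exact_mod_cast hqm)
    have hq1 : (q : ℤ) ∣ 1 := by
      have hdu : (q : ℤ) ∣ (u : ℤ) := by exact_mod_cast hqu
      have := Int.emod_emod_of_dvd (u : ℤ) (dvd_refl (q : ℤ))
      have h2 : (q : ℤ) ∣ (u : ℤ) - 1 := Int.ModEq.dvd (Int.ModEq.symm h1)
      simpa using (Int.dvd_sub hdu h2)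
    exact hq.one_lt.ne' (by exact_mod_cast Int.eq_one_of_dvd_one (by positivity) hq1)
  -- the door `d = −ℓ·u`
  obtain ⟨d, hd⟩ : ∃ d : ℤ, d = -(ℓ : ℤ) * u := ⟨_, rfl⟩
  have hdneg : d < 0 := by
    rw [hd]
    exact mul_neg_of_neg_of_pos (neg_neg_of_pos (by exact_mod_cast hℓ.pos)) (by exact_mod_cast Nat.pos_of_ne_zero hu0)
  have hdabs : d.natAbs = ℓ * u := by rw [hd, Int.natAbs_mul, Int.natAbs_neg, Int.natAbs_natCast, Int.natAbs_natCast]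
  have hℓu : ¬ ℓ ∣ u := fun h ↦ hu_ndvd ℓ hℓ h (Dvd.intro_left _ rfl)
  have hsf : Squarefree d := by
    rw [← Int.squarefree_natAbs, hdabs, Nat.squarefree_mul ((Nat.Prime.coprime_iff_not_dvd hℓ).mpr hℓu)]
    exact ⟨hℓ.squarefree, hu⟩
  have hd8 : d % 8 = 1 := by
    have h1 : (-(ℓ : ℤ)) % 8 = 1 := hdesc.2.2.1
    have h2 : (u : ℤ) % 8 = 1 % 8 := humod 8 ⟨W.conductorNorm ℤ * ℓ, by push_cast; ring⟩
    rw [hd, Int.mul_emod, h1, h2]; norm_num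
  have hjacN : ∀ p : ℕ, p.Prime → p ≠ 2 → p ∣ W.conductorNorm ℤ → jacobiSym d p = 1 := fun p hp hp2 hpN ↦ by
    haveI := Fact.mk hp
    have h1 : jacobiSym (-(ℓ : ℤ)) p = 1 :=
      hdesc.2.2.2.2 p hp hp2 fun _ ↦ (W.dvd_conductorNorm_iff_not_hasGoodReductionAtPrime p).mp hpN
    have h2 : jacobiSym (u : ℤ) p = 1 := by
      rw [jacobiSym.mod_left, humod p (by exact_mod_cast Dvd.dvd.mul_right (Dvd.dvd.mul_left hpN 8) ℓ), ← jacobiSym.mod_left]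
      exact jacobiSym.one_left p
    rw [hd, jacobiSym.mul_left, h1, h2, mul_one]
  have hprimes : ∀ q : ℕ, q.Prime → (q : ℤ) ∣ d → ¬ q ∣ W.conductorNorm ℤ := fun q hq hqd hqN ↦ by
    have hq' : q ∣ ℓ * u := hdabs ▸ Int.natCast_dvd.mp hqd
    rcases (Nat.Prime.dvd_mul hq).mp hq' with h | h
    · exact hℓN (((Nat.prime_dvd_prime_iff_eq hq hℓ).mp h) ▸ hqN)
    · exact hu_ndvd q hq h (Dvd.dvd.mul_right (Dvd.dvd.mul_left hqN 8) ℓ)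
  -- the field `K = ℚ(√d)`
  have hD : (d % 4 = 1 ∧ Squarefree d ∧ d ≠ 1) ∨ (4 ∣ d ∧ (d / 4 % 4 = 2 ∨ d / 4 % 4 = 3) ∧ Squarefree (d / 4)) :=
    Or.inl ⟨by omega, hsf, by omega⟩
  obtain ⟨K, _, _, h2K, hdisc⟩ := Quadratic.exists_numberField_discr_eq hD
  have hK : IsImaginaryQuadratic K := ⟨h2K, Quadratic.isTotallyComplex_of_discr_neg h2K (by rw [hdisc]; exact hdneg)⟩
  have hH : SatisfiesHeegnerHypothesis (W.conductorNorm ℤ) K := by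
    intro p hp hpN
    by_cases hp2 : p = 2
    · subst hp2
      have h := (Quadratic.ncard_primesOver_two_eq_two_iff h2K).mpr (by rw [hdisc]; exact hd8)
      exact_mod_cast h
    · exact (Quadratic.ncard_primesOver_eq_two_iff_jacobiSym h2K hp hp2).mpr (by rw [hdisc]; exact hjacN p hp hp2 hpN)
  have hcop : Nat.Coprime (NumberField.discr K).natAbs (W.conductorNorm ℤ) := by
    rw [hdisc]
    exact Nat.coprime_of_dvd fun q hq hqd hqN ↦ hprimes q hq (Int.natCast_dvd.mpr hqd) hqN
  have hadm : DoorAdmissible W d := by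
    refine ⟨hdneg, hsf, hd8, fun q hq hqd _ ↦ ?_, fun p hp hp2 hbad ↦ ?_⟩
    · by_contra hng
      exact hprimes q hq hqd ((W.dvd_conductorNorm_iff_not_hasGoodReductionAtPrime q).mpr hng)
    · haveI := Fact.mk hp
      exact hjacN p hp hp2 ((W.dvd_conductorNorm_iff_not_hasGoodReductionAtPrime p).mpr (hbad inferInstance))
  have hcard : twistSelmerTwoCard W d = 1 := by
    have hu0' : (u : ℚ) ≠ 0 := by exact_mod_cast hu0
    haveI := (W.quadraticTwist (((-(ℓ : ℤ) : ℤ)) : ℚ)).isElliptic_quadraticTwist hu0'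
    haveI := W.isElliptic_quadraticTwist (d := ((d : ℤ) : ℚ)) (by exact_mod_cast hdneg.ne)
    have hcast : ((d : ℤ) : ℚ) = (((-(ℓ : ℤ) : ℤ)) : ℚ) * (u : ℚ) := by rw [hd]; push_cast; ring
    have hcurve : W.quadraticTwist ((d : ℤ) : ℚ) = (W.quadraticTwist (((-(ℓ : ℤ) : ℤ)) : ℚ)).quadraticTwist (u : ℚ) := by
      rw [quadraticTwist_quadraticTwist, hcast]
    rw [pow_zero] at hSelu
    -- transport `#Sel₂` along the equality of curves (the instance arguments are propositions)
    have key : ∀ (X Y : WeierstrassCurve ℚ) [X.IsElliptic] [Y.IsElliptic], X = Y →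
        Nat.card (X.selmerGroup 2) = Nat.card (Y.selmerGroup 2) := by
      rintro X Y _ _ rfl
      rfl
    unfold twistSelmerTwoCard
    exact (key _ _ hcurve).trans hSelu
  refine ⟨K, inferInstance, inferInstance, hK, ?_, ?_, hcop, hH⟩
  · rw [hdisc]; exact hadm
  · rw [hdisc]; exact hcard

/-! ## §60 Every odd `2`-Selmer dimension, every `W` with `E(ℚ)[2] = 0` -/

/-- **THE DOOR SUPPLY FOR EVERY ODD `2`-SELMER DIMENSION AND EVERY GLOBALLY MINIMAL `W` WITH `E(ℚ)[2] = 0`** (`Δ < 0`: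
`…DoorSupplyNegDisc`; `Δ > 0`: §59). [cite: MazurRubin2010, Prop. 3.3, Cor. 3.4 (i), Lemma 3.6, Prop. 5.2, Thm. 1.5] [cite: Kramer1981, Prop. 3 and Prop. 6] -/
theorem exists_doorAdmissible_twistSelmerTwoCard_eq_one_of_odd (W : WeierstrassCurve ℚ) [W.IsElliptic] [W.IsGloballyMinimal]
    [NeZero (W.conductorNorm ℤ)] (hT : NoRationalTwoTorsion W) {k : ℕ} (hk : Nat.card (W.selmerGroup 2) = 2 ^ k) (hodd : Odd k) :
    ∃ (K : Type) (_ : Field K) (_ : NumberField K),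
      IsImaginaryQuadratic K ∧ DoorAdmissible W (NumberField.discr K) ∧ twistSelmerTwoCard W (NumberField.discr K) = 1 ∧
      Nat.Coprime (NumberField.discr K).natAbs (W.conductorNorm ℤ) ∧ SatisfiesHeegnerHypothesis (W.conductorNorm ℤ) K := by
  rcases lt_trichotomy W.Δ 0 with hΔ | hΔ | hΔ
  · exact exists_doorAdmissible_twistSelmerTwoCard_eq_one_of_negDisc W hΔ hT hk hodd
  · exact absurd hΔ W.isUnit_Δ.ne_zero
  · exact exists_doorAdmissible_twistSelmerTwoCard_eq_one_of_posDisc_of_noRationalTwoTorsion W hΔ hT hk hodd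

/-! ## §61 Rank one with `Ш(W)[2^∞]` finite; `DoorSupplyAtTwo` by name modulo the finiteness of `Ш` -/

section RankOne

variable (W : WeierstrassCurve ℚ) [W.IsElliptic] [W.IsGloballyMinimal] [NeZero (W.conductorNorm ℤ)]

/-- **THE DOOR SUPPLY ON THE WHOLE RANK-ONE HABITAT WITH `Ш(W)[2^∞]` FINITE.** `W/ℚ` globally minimal elliptic, `E(ℚ)[2] = 0`, `rank E(ℚ) = 1`,
`Ш(W)[2^∞]` finite: an imaginary quadratic `K`, `d_K` door-admissible, `#Sel₂(W^{(d_K)}) = 1`, `(d_K, N_W) = 1`, Heegner —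
`#Sel₂(W) = 2^{2r+1}` (`…DoorSupplyNegDiscSha`) fed to §60. [cite: MazurRubin2010, Cor. 3.4 (i), Prop. 5.2, Thm. 1.5] [cite: SilvermanAEC2009, Thm. X.4.14] -/
theorem exists_doorAdmissible_twistSelmerTwoCard_eq_one_of_rank_one_of_finite (hT : NoRationalTwoTorsion W)
    (hrank : W.mordellWeilRank = 1) [Finite (AddCommGroup.primaryComponent W.sha 2)] :
    ∃ (K : Type) (_ : Field K) (_ : NumberField K),
      IsImaginaryQuadratic K ∧ DoorAdmissible W (NumberField.discr K) ∧ twistSelmerTwoCard W (NumberField.discr K) = 1 ∧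
      Nat.Coprime (NumberField.discr K).natAbs (W.conductorNorm ℤ) ∧ SatisfiesHeegnerHypothesis (W.conductorNorm ℤ) K := by
  obtain ⟨r, hr⟩ := exists_natCard_selmerGroup_two_eq_pow_odd_of_rank_one W hT hrank
  exact exists_doorAdmissible_twistSelmerTwoCard_eq_one_of_odd W hT hr ⟨r, rfl⟩

/-- **The `ShaFinite` reading**: `E(ℚ)[2] = 0`, rank one, `Ш(W)` finite ⟹ a door-admissible Heegner field with `Sel₂(W^{(d_K)}) = 0`.
[cite: MazurRubin2010, Cor. 3.4 (i), Prop. 5.2, Thm. 1.5] [cite: Kramer1981, Prop. 6] -/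
theorem exists_doorAdmissible_twistSelmerTwoCard_eq_one_of_rank_one_of_shaFinite (hT : NoRationalTwoTorsion W)
    (hrank : W.mordellWeilRank = 1) (hfin : W.ShaFinite) :
    ∃ (K : Type) (_ : Field K) (_ : NumberField K),
      IsImaginaryQuadratic K ∧ DoorAdmissible W (NumberField.discr K) ∧ twistSelmerTwoCard W (NumberField.discr K) = 1 ∧
      Nat.Coprime (NumberField.discr K).natAbs (W.conductorNorm ℤ) ∧ SatisfiesHeegnerHypothesis (W.conductorNorm ℤ) K := by
  haveI : Finite W.sha := hfin
  exact exists_doorAdmissible_twistSelmerTwoCard_eq_one_of_rank_one_of_finite W hT hrank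

omit [W.IsElliptic] [W.IsGloballyMinimal] [NeZero (W.conductorNorm ℤ)] in
/-- `Ш(W)[2] = 0` ⟹ `Ш(W)[2^∞] = 0`, in particular finite (`2^{n+1} x = 0 ⟹ 2^n (2x) = 0 ⟹ 2x = 0 ⟹ x = 0`). [folklore] -/
theorem finite_primaryComponent_sha_two_of_shaTwoTrivial (hSha : ShaTwoTrivial W) : Finite (AddCommGroup.primaryComponent W.sha 2) := by
  have hkill : ∀ n : ℕ, ∀ x : W.sha, 2 ^ n • x = 0 → x = 0 := by
    intro n
    induction n with
    | zero => intro x hx; simpa using hx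
    | succ n ih =>
      intro x hx
      have h2x : 2 ^ n • (2 • x) = 0 := by rw [smul_smul, ← pow_succ]; exact hx
      have h2 : 2 • x = 0 := ih _ h2x
      exact Subtype.ext (hSha x x.2 (by exact_mod_cast congrArg Subtype.val h2))
  haveI : Subsingleton (AddCommGroup.primaryComponent W.sha 2) := by
    refine ⟨fun a b ↦ Subtype.ext ?_⟩
    obtain ⟨n, hn⟩ := (AddCommGroup.mem_primaryComponent).mp a.2
    obtain ⟨m, hm⟩ := (AddCommGroup.mem_primaryComponent).mp b.2
    rw [hkill n a.1 hn, hkill m b.1 hm]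
  infer_instance

/-- **The slice reading without `Δ ∉ ℚ²`**: `E(ℚ)[2] = 0`, rank one, `Ш(W)[2] = 0` ⟹ a door-admissible Heegner field with `Sel₂(W^{(d_K)}) = 0`
(supersedes `…DoorSupplySlice.exists_doorAdmissible_twistSelmerTwoCard_eq_one`, which assumed `Δ_W ∉ ℚ²`). [cite: MazurRubin2010, Prop. 3.3, Cor. 3.4 (i),
Lemma 3.5] [cite: Kramer1981, Prop. 6] -/
theorem exists_doorAdmissible_twistSelmerTwoCard_eq_one_of_rank_one_of_shaTwoTrivial (hT : NoRationalTwoTorsion W)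
    (hrank : W.mordellWeilRank = 1) (hSha : ShaTwoTrivial W) :
    ∃ (K : Type) (_ : Field K) (_ : NumberField K),
      IsImaginaryQuadratic K ∧ DoorAdmissible W (NumberField.discr K) ∧ twistSelmerTwoCard W (NumberField.discr K) = 1 ∧
      Nat.Coprime (NumberField.discr K).natAbs (W.conductorNorm ℤ) ∧ SatisfiesHeegnerHypothesis (W.conductorNorm ℤ) K := by
  haveI := finite_primaryComponent_sha_two_of_shaTwoTrivial W hSha
  exact exists_doorAdmissible_twistSelmerTwoCard_eq_one_of_rank_one_of_finite W hT hrank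

end RankOne

/-- **`RankOneAtTwoOneDoor.DoorSupplyAtTwo` ⟸ «`Ш(W)[2^∞]` is finite for every globally minimal rank-one `W` with `E(ℚ)[2] = 0`»** (the exact
residual input of the `L`-free supply). [cite: MazurRubin2010, Prop. 3.3, Cor. 3.4 (i), Lemma 3.5, Prop. 5.2, Thm. 1.5] -/
theorem doorSupplyAtTwo_of_forall_finite_primaryComponent
    (hfin : ∀ (W : WeierstrassCurve ℚ) [W.IsElliptic] [W.IsGloballyMinimal], NoRationalTwoTorsion W → W.mordellWeilRank = 1 →
      Finite (AddCommGroup.primaryComponent W.sha 2)) :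
    DoorSupplyAtTwo := by
  intro W _ _ _ hT hrank
  haveI := hfin W hT hrank
  exact exists_doorAdmissible_twistSelmerTwoCard_eq_one_of_rank_one_of_finite W hT hrank

/-- **`RankOneAtTwoOneDoor.DoorSupplyAtTwo` BY NAME, MODULO THE FINITENESS OF `Ш`** (the registered conjecture `ShaFiniteConjecture`; on the
analytic-rank-one habitat of the fkl glue it is Kolyvagin's theorem, carried there by `S_pub`): the fkl line's AN-27 supply — for every globally
minimal `W` with `E(ℚ)[2] = 0` and rank one, an imaginary quadratic `K` with `d_K` door-admissible, `Sel₂(W^{(d_K)}) = 0`, `(d_K, N_W) = 1`, Heegner.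
CONDITIONAL on `hsha` only; everything else is a tree theorem. [cite: MazurRubin2010, Prop. 3.3, Cor. 3.4 (i), Lemma 3.5, Prop. 5.2, Thm. 1.5]
[cite: Kramer1981, Prop. 3 and Prop. 6] [cite: Tate1974, Conj. 1] -/
theorem doorSupplyAtTwo_of_shaFiniteConjecture (hsha : ShaFiniteConjecture) : DoorSupplyAtTwo :=
  doorSupplyAtTwo_of_forall_finite_primaryComponent fun W _ _ _ _ ↦ by
    haveI : Finite W.sha := hsha W inferInstance
    infer_instance

end Summit.BirchSwinnertonDyer.BirchSwinnertonDyer.Theorems.GenusKolyTransp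

end
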